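import Literature.RepresentationTheory.MoeglinVignerasWaldspurger1987.RankOneThetaLiftLinesDisjointHolds
import HarnessLib

/-!
# Rank-one theta lifts to `U(V)` from two skew-hermitian LINES of different classes are DISJOINT at every non-split place
# where `V` has an ISOTROPIC vector — every rank `N ≥ 2`, arbitrary splittings and characters (the `n = 2` isotropic case of
# [Liu2021, Lem. D.1 (4)], `ε`-clause; [HarrisKudlaSweet1996, Cor. 4.4]; [SunZhu2014, Thm. 1.10])

Topic `RepresentationTheory/MoeglinVignerasWaldspurger1987`; namespace `Literature.RepresentationTheory.MoeglinVignerasWaldspurger1987`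
(that of ★ `RankOneThetaLiftLinesDisjoint(Holds)`).  THEOREMS ONLY (no definition, no named fact, no `sorry`, no instance, no notation).
Cell hodgecm-mathlib, FLOOR 0, half A line LD1 (socket `stub_S1_facts`, #73) — the ISOTROPIC-PLACE half of the shared printed
letter R₂ ∕ L4 of the LD leaves (★ `LemD1RankTwoCMLetters.LemD1_4SameLabelNonsplitCM₂` ∕ `LemD1_4AsPrintedNonsplitCM₂`);
`--supports stmt-HodgeConjecture-24832`.

THE POINT.  The named fact ★ `rankOne_theta_lines_disjoint` (`RankOneThetaLiftLinesDisjoint.lean`) — «a non-zero rank-one theta lift to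
`U(J)(F_v)` from the line `W_{ε₁}` is never isomorphic to a rank-one theta lift from the line `W_{ε₂}` of the other class of
`E_v^{−×}/Nm E_vˣ`, for ARBITRARY splittings `s₁, s₂` over `ι_{δ₁}, ι_{δ₂}` and unitary continuous `χ₁, χ₂`» — is stated and PROVED
(★ `rankOne_theta_lines_disjoint_holds`) at `N = 3` only.  Its proof, the cell's «compact (anisotropic) doubling ∕ root-subgroup support»
argument (pieces P1–P7, crew A-p15 · A-p05 · B-p01 · B-p04 · B-p05 · B-p10 · B-p11 · B-p17), uses the rank hypothesis `3 ≤ N` at exactly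
ONE point: to PICK an isotropic vector `r ≠ 0` of `(E_vᴺ, J ⊗ 1)` (★ `exists_isotropic_localGram`, inside ★ `exists_doubledRootNilpotents`
:271) — a hermitian space of rank `≥ 3` over the quadratic field `E_v` is isotropic.  Every other piece is rank-generic: P1 ★
`exists_doubledFunctional_of_areIsomorphicRep` (any `N`), the doubled root nilpotents of §1 of ★ `RankOneThetaLinesDoubledRootForm` (any `N`,
given the hyperbolic pair), the polarisation mover ★ `exists_mover_two_rootFamilies` (any index split `ι₁ ⊕ ι₂`), and the ENGINE ★
`false_of_quasiInvariant_rootFamilies` (needs only `Nonempty ι₁`; here `ι₁ = Fin 4` = the rank of the doubled nilpotent at every `N`).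
This file records the rank-generic theorem the same proof gives when the isotropic vector is SUPPLIED:

* `exists_doubledRootNilpotents_of_isotropic` — ★ `exists_doubledRootNilpotents` with the binder `3 ≤ N` replaced by an isotropic `r ≠ 0`
  (the proof is that of the ★ theorem verbatim, minus the line that picked `r`);
* **`rankOne_theta_lines_disjoint_of_isotropic`** — the text of ★ `rankOne_theta_lines_disjoint` with `3 ↦ N`, `2 ≤ N`, and the extra
  hypothesis «`(E_vᴺ, J ⊗ 1)` has an isotropic vector»: a non-zero `Θ_{s₁}(χ₁)` is never isomorphic (`AreIsomorphicRep`) to `Θ_{s₂}(χ₂)`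
  when the lines `δ₁ ⊗ 1`, `δ₂ ⊗ 1` lie in different classes (index split `Fin 4 ⊕ Fin (N + N − 4) ≃ Fin (N + N)`; assembly = that of ★
  `rankOne_theta_lines_disjoint_holds` verbatim);
* `rankOne_theta_lines_disjoint_of_isIsotropic_standingData` — the same with the isotropy hypothesis in the Step-1 currency
  `LemD1.IsIsotropic (LemD1OfPlace.standingData E v c N J …)` of ★ `LemD1AsPrinted` ∕ ★ `LemD1DataOfPlace` (the reading the Liu-side
  consumers quantify over: [Liu2021, Lem. D.1 (4)] «`V` is isotropic»).

WHAT IT PAYS (numbers, not adjectives).  At `N = 2` and a non-split `v` where the hermitian PLANE `V_v` is isotropic — all but the finitely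
many `v` with `(d, −t₀t₁)_v = −1` (★ `LemD1OfPlace.not_isIsotropic_standingData_iff_hilbertSymbol_eq_neg_one`, ★ `finite_setOf_not_isIsotropic`)
— this is the `ε`-clause of [Liu2021, Lem. D.1 (4)] for EVERY pair of labels `(μ, χ), (μ′, χ′)` («if `V` is isotropic, then `ε′` and `ε`
are in the same class»), i.e. theta dichotomy ∕ conservation for the pair `(U(1), U(1,1))` [HarrisKudlaSweet1996, Cor. 4.4; SunZhu2014,
Thm. 1.10], with NO condition on the splittings — in particular the same-label rigidity R₂ at those places needs no pin of the CM sections.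
At an ANISOTROPIC plane the splitting-free statement is FALSE ([Liu2021, Lem. D.1 (4)]: `ω(μ, ε, χ) ≅ ω(μᶜχ̌, ε′, χ)` with `ε′ ≁ ε` when
non-zero), so the finitely many anisotropic places are NOT covered here (they are the (P)∕torus road of the LD bus, 2026-09-02).

HONEST SCOPE.  Nothing of [Liu2021] is asserted; no book row moves by this file alone; HC_CM is proved only modulo the 7 printed citations
(2 remaining: hLiu418 = stmt-HodgeConjecture-24832, h413 = stmt-HodgeConjecture-24833) until rung 0 closes; count-neutral.

## References
* [MoeglinVignerasWaldspurger1987] C. Mœglin, M.-F. Vignéras, J.-L. Waldspurger, *Correspondances de Howe sur un corps p-adique*, LNM 1291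
  (1987), Chap. 3 §IV.4 (theta dichotomy for unitary dual pairs); Chap. 1 I.17; Chap. 2 II.1 Rem. (6), II.6–II.7.
* [HarrisKudlaSweet1996] M. Harris, S. Kudla, W. J. Sweet, *Theta dichotomy for unitary groups*, J. AMS 9 (1996), Cor. 4.4 p. 962.
* [SunZhu2014] B. Sun, C.-B. Zhu, *Conservation relations for local theta correspondence*, J. AMS 28 (2015), Thm. 1.10.
* [Liu2021] Y. Liu, Camb. J. Math. 9 (2021) = arXiv:2102.11518, App. D Lem. D.1 (3), (4) (p. 125–126, TeX l. 5233–5235), proof l. 5255–5262.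
-/

set_option autoImplicit false

noncomputable section

open NumberField IsDedekindDomain MeasureTheory Matrix
open Literature.RepresentationTheory Literature.RepresentationTheory.HeisenbergGroup
open Literature.NumberTheory.GelbartRogawski1991.UnitaryDualPair.LocalSplitting
open Literature.NumberTheory.Automorphic Literature.NumberTheory.Automorphic.UnitaryGroup
open Literature.NumberTheory.Automorphic.Liu2021

namespace Literature.RepresentationTheory.MoeglinVignerasWaldspurger1987

/-! ## §1 The doubled root nilpotents from a SUPPLIED isotropic vector (every rank `N`) -/

section Packaged

variable (F : Type) [Field F] [NumberField F] (E : Type) [Field E] [NumberField E] [Algebra F E]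
  [Algebra.IsQuadraticExtension F E] (c : E ≃ₐ[F] E) {N : ℕ}
  {δ₁ : E} (hcδ₁ : c δ₁ = -δ₁) (hδ₁ : δ₁ ≠ 0) {d₁ : F} (hd₁ : δ₁ * δ₁ = algebraMap F E d₁)
  {δ₂ : E} (hcδ₂ : c δ₂ = -δ₂) (hδ₂ : δ₂ ≠ 0) {d₂ : F} (hd₂ : δ₂ * δ₂ = algebraMap F E d₂)
  (T : Matrix (Fin N) (Fin N) F) (hT : T.IsSymm) (hTd : IsUnit T.det)
  {J : Matrix (Fin N) (Fin N) E} (hJ : J = T.map (algebraMap F E)) (v : HeightOneSpectrum (𝓞 F))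

include hTd in
set_option maxHeartbeats 800000 in -- the twelve-clause packaging statement (as for ★ `exists_doubledRootNilpotents`)
/-- **The doubled root nilpotents of an ISOTROPIC vector, every rank `N`.**  ★ `exists_doubledRootNilpotents` with its binder
`3 ≤ N` replaced by a SUPPLIED isotropic `r ≠ 0` of `(E_vᴺ, J ⊗ 1)` (`E_v` a field, the class hypothesis `ε₂ ∉ ε₁ · Nm`, sections
`s₁, s₂` of the metaplectic cover over `ι_{δ₁}, ι_{δ₂}`): with the hyperbolic partner `r'` of `r`, the two one-parameter families
`nr = n_{•δ₁}(r)`, `nr' = n_{•δ₁}(r')` in `U(V)(F_v)` have diagonal doublings acting on `𝕎 ⊕ 𝕎⁻` as `1 + t 𝔫`, `1 + t 𝔫'` with `𝔫, 𝔫'`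
of square zero, skew for `A^⊕`, with images of dimension `4` in duality, and with ANISOTROPIC norm forms modulo their kernels.  The proof is
that of the ★ theorem verbatim (the rank hypothesis was used there only to pick `r`).
[cite: MoeglinVignerasWaldspurger1987, Chap. 3 IV.4; Chap. 1 I.17; Chap. 2 II.1 Rem. (6)] [cite: Liu2021, App. D Lem. D.1 (3), (4)] -/
theorem exists_doubledRootNilpotents_of_isotropic (hE : IsField (LocalRing E v))
    (hcls : ¬ ∃ x : (LocalRing E v)ˣ,
      Liu2021.LemD1OfPlace.eps E v hδ₂ = x * Units.map (conjLocal E c v : LocalRing E v →* LocalRing E v) x * Liu2021.LemD1OfPlace.eps E v hδ₁)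
    {r : Fin N → LocalRing E v} (hr0 : r ≠ 0)
    (hr : hermForm (conjLocal E c v) ((adelicForm E N J).map (adeleToLocal E v)) r r = 0)
    (s₁ s₂ : UnitaryGroup.localPi E c N J v →* LocalMp F N T v)
    (hs₁ : ∀ g, MpPsi.proj _ (s₁ g) = iota F E c N hcδ₁ hδ₁ hd₁ T hT hJ v g)
    (hs₂ : ∀ g, MpPsi.proj _ (s₂ g) = iota F E c N hcδ₂ hδ₂ hd₂ T hT hJ v g) :
    ∃ (nr nr' : v.adicCompletion F → UnitaryGroup.localPi E c N J v)
      (𝔫 𝔫' : ((Fin (N + N) → v.adicCompletion F) × (Fin (N + N) → v.adicCompletion F)) →ₗ[v.adicCompletion F]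
        ((Fin (N + N) → v.adicCompletion F) × (Fin (N + N) → v.adicCompletion F))),
      (∀ t w, ((MpPsi.proj _ (diagonalDoubling F E c v N s₁ s₂ (nr t)) : LocalSp F (N + N) (gramD F N T) v) :
          ((Fin (N + N) → v.adicCompletion F) × (Fin (N + N) → v.adicCompletion F)) ≃ₗ[v.adicCompletion F]
            ((Fin (N + N) → v.adicCompletion F) × (Fin (N + N) → v.adicCompletion F))) w = w + t • 𝔫 w) ∧
      (∀ t w, ((MpPsi.proj _ (diagonalDoubling F E c v N s₁ s₂ (nr' t)) : LocalSp F (N + N) (gramD F N T) v) :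
          ((Fin (N + N) → v.adicCompletion F) × (Fin (N + N) → v.adicCompletion F)) ≃ₗ[v.adicCompletion F]
            ((Fin (N + N) → v.adicCompletion F) × (Fin (N + N) → v.adicCompletion F))) w = w + t • 𝔫' w) ∧
      𝔫 ∘ₗ 𝔫 = 0 ∧ 𝔫' ∘ₗ 𝔫' = 0 ∧
      (∀ p q, alt (polar (localPairing F (N + N) (gramD F N T) v)) (𝔫 p) q =
        - alt (polar (localPairing F (N + N) (gramD F N T) v)) p (𝔫 q)) ∧
      (∀ p q, alt (polar (localPairing F (N + N) (gramD F N T) v)) (𝔫' p) q =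
        - alt (polar (localPairing F (N + N) (gramD F N T) v)) p (𝔫' q)) ∧
      Disjoint (LinearMap.range 𝔫)
        (LinearMap.BilinForm.orthogonal (alt (polar (localPairing F (N + N) (gramD F N T) v))) (LinearMap.range 𝔫')) ∧
      Disjoint (LinearMap.range 𝔫')
        (LinearMap.BilinForm.orthogonal (alt (polar (localPairing F (N + N) (gramD F N T) v))) (LinearMap.range 𝔫)) ∧
      Module.finrank (v.adicCompletion F) (LinearMap.range 𝔫) = 4 ∧
      Module.finrank (v.adicCompletion F) (LinearMap.range 𝔫') = 4 ∧
      (∀ w, alt (polar (localPairing F (N + N) (gramD F N T) v)) w (𝔫 w) = 0 → 𝔫 w = 0) ∧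
      (∀ w, alt (polar (localPairing F (N + N) (gramD F N T) v)) w (𝔫' w) = 0 → 𝔫' w = 0) := by
  have hJh : (J.map c)ᵀ = J := by
    rw [hJ, Matrix.map_map]
    have h : (⇑c ∘ ⇑(algebraMap F E)) = ⇑(algebraMap F E) := funext fun t => c.commutes t
    rw [h, ← Matrix.transpose_map, hT.eq]
  have hJdet : J.det ≠ 0 := by
    rw [hJ]
    exact (isUnit_det_map (algebraMap F E) hTd).ne_zero
  obtain ⟨a, ha⟩ := exists_eq_algebraMap_mul_of_apply_eq_neg E c hcδ₁ hδ₁ hcδ₂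
  obtain ⟨r', hr', hrr'⟩ := exists_hyperbolic_partner_localGram E c N J v hcδ₁ hδ₁ hE hJh hJdet hr hr0
  have hr'r := hermForm_localGram_partner_symm E c N J v hcδ₁ hδ₁ hJh hrr'
  -- the two doubled nilpotents (opaque `D`, `D'` with their block descriptions)
  have hDex : ∀ x : Fin N → LocalRing E v,
      ∃ D : ((Fin (N + N) → v.adicCompletion F) × (Fin (N + N) → v.adicCompletion F)) →ₗ[v.adicCompletion F]
        ((Fin (N + N) → v.adicCompletion F) × (Fin (N + N) → v.adicCompletion F)),
        ∀ w, D w = (splitW (K := v.adicCompletion F) (e₂ N)).symm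
          (localRootNil E c N J v hcδ₁ hδ₁ hd₁ x (splitW (e₂ N) w).1,
            (((a : v.adicCompletion F))⁻¹ • localRootNil E c N J v hcδ₂ hδ₂ hd₂ x) (splitW (e₂ N) w).2) := fun x =>
    ⟨(splitW (K := v.adicCompletion F) (e₂ N)).symm.toLinearMap ∘ₗ
      ((localRootNil E c N J v hcδ₁ hδ₁ hd₁ x).prodMap (((a : v.adicCompletion F))⁻¹ • localRootNil E c N J v hcδ₂ hδ₂ hd₂ x)) ∘ₗ
        (splitW (K := v.adicCompletion F) (e₂ N)).toLinearMap, fun w => by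
      simp only [LinearMap.comp_apply, LinearEquiv.coe_toLinearMap, LinearMap.prodMap_apply]⟩
  obtain ⟨D, hD⟩ := hDex r
  obtain ⟨D', hD'⟩ := hDex r'
  refine ⟨fun t => localRootElt E c N J v hcδ₁ hδ₁ hJh hr t, fun t => localRootElt E c N J v hcδ₁ hδ₁ hJh hr' t, D, D',
    fun t w => ?_, fun t w => ?_, ?_, ?_, ?_, ?_, ?_, ?_, ?_, ?_, fun w => ?_, fun w => ?_⟩
  · exact proj_diagonalDoubling_localRootElt_apply F E c N J v hcδ₁ hδ₁ hd₁ hcδ₂ hδ₂ hd₂ ha T hT hJ r D hD s₁ s₂ hs₁ hs₂ hJh hr t w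
  · exact proj_diagonalDoubling_localRootElt_apply F E c N J v hcδ₁ hδ₁ hd₁ hcδ₂ hδ₂ hd₂ ha T hT hJ r' D' hD' s₁ s₂ hs₁ hs₂ hJh hr' t w
  · exact doubledRootNil_comp_self F E c N J v hcδ₁ hδ₁ hd₁ hcδ₂ hδ₂ hd₂ r D hD hr
  · exact doubledRootNil_comp_self F E c N J v hcδ₁ hδ₁ hd₁ hcδ₂ hδ₂ hd₂ r' D' hD' hr'
  · exact alt_polar_doubledRootNil_skew F E c N J v hcδ₁ hδ₁ hd₁ hcδ₂ hδ₂ hd₂ T hT hJ r D hD hJh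
  · exact alt_polar_doubledRootNil_skew F E c N J v hcδ₁ hδ₁ hd₁ hcδ₂ hδ₂ hd₂ T hT hJ r' D' hD' hJh
  · exact disjoint_range_doubledRootNil_orthogonal F E c N J v hcδ₁ hδ₁ hd₁ hcδ₂ hδ₂ hd₂ ha T hT hJ r D hD hE hrr' hr'r D' hD'
  · exact disjoint_range_doubledRootNil_orthogonal F E c N J v hcδ₁ hδ₁ hd₁ hcδ₂ hδ₂ hd₂ ha T hT hJ r' D' hD' hE hr'r hrr' D hD
  · exact finrank_range_doubledRootNil F E c N J v hcδ₁ hδ₁ hd₁ hcδ₂ hδ₂ hd₂ ha r D hD hE hrr'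
  · exact finrank_range_doubledRootNil F E c N J v hcδ₁ hδ₁ hd₁ hcδ₂ hδ₂ hd₂ ha r' D' hD' hE hr'r
  · exact doubledRootNil_eq_zero_of_alt_polar_self_eq_zero F E c N J v hcδ₁ hδ₁ hd₁ hcδ₂ hδ₂ hd₂ ha T hT hJ r D hD hE hcls hJh w
  · exact doubledRootNil_eq_zero_of_alt_polar_self_eq_zero F E c N J v hcδ₁ hδ₁ hd₁ hcδ₂ hδ₂ hd₂ ha T hT hJ r' D' hD' hE hcls hJh w

end Packaged

/-! ## §2 The disjointness of the two lines' theta lifts at an isotropic `V`, every rank `N ≥ 2` -/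

set_option maxHeartbeats 1000000 in -- the 17-binder `hP34` statement + the engine application (as for ★ `rankOne_theta_lines_disjoint_holds`)
/-- **[HarrisKudlaSweet1996, Cor. 4.4] ∕ [SunZhu2014, Thm. 1.10] ∕ [Liu2021, Lem. D.1 (3)–(4), `ε`-clause] at an ISOTROPIC `V`, every rank
`N ≥ 2`, non-split place — PROVED**: for `E/F` quadratic, `c`, trace-zero `δ₁, δ₂ ≠ 0` whose local representatives `ε₁ = δ₁ ⊗ 1`,
`ε₂ = δ₂ ⊗ 1 ∈ E_vˣ` lie in DIFFERENT classes of `E_v^{−×}/Nm E_vˣ` (`¬ ∃ x, ε₂ = x · xᶜ · ε₁`), `T ∈ M_N(F)` symmetric with `det T` a unit,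
`J = T ⊗ 1`, a finite place `v` with `E_v` a field at which `(E_vᴺ, J ⊗ 1)` has an ISOTROPIC vector `r ≠ 0`, splittings `s₁` over `ι_{δ₁}`
and `s₂` over `ι_{δ₂}` with `ω_{sᵢ}` smooth, a hermitian line `J₁` and unitary continuous `χ₁, χ₂` of `U(J₁)(F_v) = E_v¹`: it is IMPOSSIBLE
that `Θ_{s₁}(χ₁) ≠ 0` and `Θ_{s₁}(χ₁) ≅ Θ_{s₂}(χ₂)` as representations of `U(J)(F_v)` (`AreIsomorphicRep`).  Proof: the anisotropic-doubling ∕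
root-subgroup support argument of ★ `rankOne_theta_lines_disjoint_holds` verbatim, the isotropic vector being supplied instead of picked
(`exists_doubledRootNilpotents_of_isotropic`; index split `Fin 4 ⊕ Fin (N + N − 4) ≃ Fin (N + N)`).  At `N = 2` this is the `ε`-clause of
[Liu2021, Lem. D.1 (4)] at an isotropic plane for all labels; at an anisotropic plane the splitting-free statement is false and is not claimed.
[cite: HarrisKudlaSweet1996, Cor. 4.4 p. 962] [cite: SunZhu2014, Thm. 1.10] [cite: Liu2021, App. D Lemma D.1 (3), (4) (p. 125–126, l. 5233–5235)]
[cite: MoeglinVignerasWaldspurger1987, Chap. 3 IV.4] -/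
theorem rankOne_theta_lines_disjoint_of_isotropic (F : Type) [Field F] [NumberField F] (E : Type) [Field E] [NumberField E]
    [Algebra F E] [Algebra.IsQuadraticExtension F E] (c : E ≃ₐ[F] E) {N : ℕ} (hN : 2 ≤ N)
    (δ₁ : E) (hcδ₁ : c δ₁ = -δ₁) (hδ₁ : δ₁ ≠ 0) (d₁ : F) (hd₁ : δ₁ * δ₁ = algebraMap F E d₁)
    (δ₂ : E) (hcδ₂ : c δ₂ = -δ₂) (hδ₂ : δ₂ ≠ 0) (d₂ : F) (hd₂ : δ₂ * δ₂ = algebraMap F E d₂)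
    (T : Matrix (Fin N) (Fin N) F) (hT : T.IsSymm) (hTd : IsUnit T.det)
    (J : Matrix (Fin N) (Fin N) E) (hJ : J = T.map (algebraMap F E)) (v : HeightOneSpectrum (𝓞 F))
    (hE : IsField (UnitaryGroup.LocalRing E v))
    (hcls : ¬ ∃ x : (UnitaryGroup.LocalRing E v)ˣ,
      LemD1OfPlace.eps E v hδ₂ = x * Units.map (UnitaryGroup.conjLocal E c v : UnitaryGroup.LocalRing E v →* UnitaryGroup.LocalRing E v) x *
        LemD1OfPlace.eps E v hδ₁)
    (hiso : ∃ r : Fin N → UnitaryGroup.LocalRing E v, r ≠ 0 ∧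
      hermForm (UnitaryGroup.conjLocal E c v) ((UnitaryGroup.adelicForm E N J).map (UnitaryGroup.adeleToLocal E v)) r r = 0)
    (s₁ s₂ : UnitaryGroup.localPi E c N J v →* LocalMp F N T v)
    (hs₁ : ∀ g, MpPsi.proj _ (s₁ g) = iota F E c N hcδ₁ hδ₁ hd₁ T hT hJ v g)
    (hs₂ : ∀ g, MpPsi.proj _ (s₂ g) = iota F E c N hcδ₂ hδ₂ hd₂ T hT hJ v g)
    (_hsm₁ : Representation.IsSmooth ((MpPsi.toRep (localSchrodinger F N T v)).comp s₁))
    (hsm₂ : Representation.IsSmooth ((MpPsi.toRep (localSchrodinger F N T v)).comp s₂))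
    (J₁ : Matrix (Fin 1) (Fin 1) E) (hJ₁ : J₁ 0 0 ≠ 0) (χ₁ χ₂ : UnitaryGroup.localPi E c 1 J₁ v →* ℂˣ)
    (_hχ₁u : ∀ z, ‖((χ₁ z : ℂˣ) : ℂ)‖ = 1) (_hχ₁c : Continuous fun z => ((χ₁ z : ℂˣ) : ℂ))
    (_hχ₂u : ∀ z, ‖((χ₂ z : ℂˣ) : ℂ)‖ = 1) (hχ₂c : Continuous fun z => ((χ₂ z : ℂˣ) : ℂ))
    (hnt : Nontrivial (TwistedCoinv.Coinv
      ((show Representation ℂ (UnitaryGroup.localPi E c 1 J₁ v) (SchwartzBruhat (Fin N → v.adicCompletion F)) from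
        ((MpPsi.toRep (localSchrodinger F N T v)).comp s₁).comp (UnitaryGroup.localCenter E c N J J₁ hJ₁ v))) χ₁))
    (hiso' : AreIsomorphicRep
      (TwistedCoinv.rep
        (ρW := show Representation ℂ (UnitaryGroup.localPi E c 1 J₁ v) (SchwartzBruhat (Fin N → v.adicCompletion F)) from
          ((MpPsi.toRep (localSchrodinger F N T v)).comp s₁).comp (UnitaryGroup.localCenter E c N J J₁ hJ₁ v))
        χ₁ ((MpPsi.toRep (localSchrodinger F N T v)).comp s₁)
        (fun g z => (show Commute g (UnitaryGroup.localCenter E c N J J₁ hJ₁ v z) from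
          UnitaryGroup.localCenter_comm E c N J J₁ hJ₁ v z g).map ((MpPsi.toRep (localSchrodinger F N T v)).comp s₁)))
      (TwistedCoinv.rep
        (ρW := show Representation ℂ (UnitaryGroup.localPi E c 1 J₁ v) (SchwartzBruhat (Fin N → v.adicCompletion F)) from
          ((MpPsi.toRep (localSchrodinger F N T v)).comp s₂).comp (UnitaryGroup.localCenter E c N J J₁ hJ₁ v))
        χ₂ ((MpPsi.toRep (localSchrodinger F N T v)).comp s₂)
        (fun g z => (show Commute g (UnitaryGroup.localCenter E c N J J₁ hJ₁ v z) from
          UnitaryGroup.localCenter_comm E c N J J₁ hJ₁ v z g).map ((MpPsi.toRep (localSchrodinger F N T v)).comp s₂)))) :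
    False := by
  classical
  -- P1: the doubled functional on `𝒮(F_v^{N+N})` along `e₂ N`
  obtain ⟨Λ, hΛ0, hΛ⟩ := exists_doubledFunctional_of_areIsomorphicRep F E c hcδ₁ hδ₁ N T hTd J v hE s₁ s₂ hsm₂ J₁ hJ₁ χ₁
    χ₂ hχ₂c hnt hiso' (e₂ N)
  -- P1 ↔ 𝔻: `Λ` is an eigenvector of every `op(𝔻 u)`
  have hΛ𝔻 : ∀ u : localPi E c N J v, ∃ r : ℂ, ∀ f,
      Λ (MpPsi.toOp _ (diagonalDoubling F E c v N s₁ s₂ u) f) = r • Λ f := by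
    intro u
    obtain ⟨r, -, h⟩ := hΛ u
    refine ⟨r, fun f => ?_⟩
    have key : ((MpPsi.toOp _ (diagonalDoubling F E c v N s₁ s₂ u) :
        SchwartzBruhat (Fin (N + N) → v.adicCompletion F) ≃ₗ[ℂ] SchwartzBruhat (Fin (N + N) → v.adicCompletion F)) :
        SchwartzBruhat (Fin (N + N) → v.adicCompletion F) →ₗ[ℂ] SchwartzBruhat (Fin (N + N) → v.adicCompletion F)) =
        sumEndSB (v.adicCompletion F) (e₂ N)
          ((((MpPsi.toRep (localSchrodinger F N T v)).comp s₁) u : SchwartzBruhat (Fin N → v.adicCompletion F) →ₗ[ℂ]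
            SchwartzBruhat (Fin N → v.adicCompletion F)))
          (conjOp (MpPsi.toOp (localSchrodinger F N T v) (s₂ u))).toLinearMap := by
      rw [toOp_diagonalDoubling, boxEquivSB_toLinearMap, MonoidHom.comp_apply, MpPsi.toRep_eq_toOp]
    have h' := LinearMap.congr_fun h f
    rw [← key, LinearMap.comp_apply, LinearMap.smul_apply, LinearEquiv.coe_coe] at h'
    exact h'
  -- the P6 coordinate splitting of the doubled index: `ι₁ = Fin 4` (quaternary block), `ι₂ = Fin (N + N - 4)`
  obtain ⟨e', -⟩ : ∃ _e : Fin 4 ⊕ Fin (N + N - 4) ≃ Fin (N + N), True :=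
    ⟨finSumFinEquiv.trans (finCongr (by omega)), trivial⟩
  -- the supplied isotropic vector
  obtain ⟨r, hr0, hr⟩ := hiso
  -- P3 (given `r`) + P4: the two root families, their doubled nilpotents, the mover and the forms
  have hP34 : ∃ (nr nr' : v.adicCompletion F → localPi E c N J v)
      (𝔫 𝔫' : ((Fin (N + N) → v.adicCompletion F) × (Fin (N + N) → v.adicCompletion F)) →ₗ[v.adicCompletion F]
        ((Fin (N + N) → v.adicCompletion F) × (Fin (N + N) → v.adicCompletion F))),
      (∀ t w, ((MpPsi.proj _ (diagonalDoubling F E c v N s₁ s₂ (nr t)) : LocalSp F (N + N) (gramD F N T) v) :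
        _ ≃ₗ[v.adicCompletion F] _) w = w + t • 𝔫 w) ∧
      (∀ t w, ((MpPsi.proj _ (diagonalDoubling F E c v N s₁ s₂ (nr' t)) : LocalSp F (N + N) (gramD F N T) v) :
        _ ≃ₗ[v.adicCompletion F] _) w = w + t • 𝔫' w) ∧
      ∃ (g₀ : LocalSp F (N + N) (gramD F N T) v)
        (c₀ c₀' : (Fin (N + N) → v.adicCompletion F) →ₗ[v.adicCompletion F] (Fin (N + N) → v.adicCompletion F))
        (hc₀ : ∀ x x', localPairing F (N + N) (gramD F N T) v x (c₀ x') = localPairing F (N + N) (gramD F N T) v x' (c₀ x))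
        (hc₀' : ∀ x x', localPairing F (N + N) (gramD F N T) v x (c₀' x') =
          localPairing F (N + N) (gramD F N T) v x' (c₀' x)),
        (∀ x, localPairing F (N + N) (gramD F N T) v x (c₀ x) =
          localPairing F (N + N) (gramD F N T) v (glue e' (resL e' x) 0)
            (c₀ (glue e' (resL e' x) 0))) ∧
        (∀ x, localPairing F (N + N) (gramD F N T) v x (c₀' x) =
          localPairing F (N + N) (gramD F N T) v (glue e' (resL e' x) 0)
            (c₀' (glue e' (resL e' x) 0))) ∧
        (∀ ξ : Fin 4 → v.adicCompletion F,
          localPairing F (N + N) (gramD F N T) v (glue e' ξ 0) (c₀ (glue e' ξ 0)) = 0 → ξ = 0) ∧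
        (∀ ξ : Fin 4 → v.adicCompletion F,
          localPairing F (N + N) (gramD F N T) v (glue e' ξ 0) (c₀' (glue e' ξ 0)) = 0 → ξ = 0) ∧
        (∀ (t : v.adicCompletion F) (u : LocalSp F (N + N) (gramD F N T) v),
          (∀ w, (u : _ ≃ₗ[v.adicCompletion F] _) w = w + t • 𝔫 w) →
            g₀ * u * g₀⁻¹ = unipotentSp (localPairing F (N + N) (gramD F N T) v) (t • c₀)
              (symm_smul_of_symm (localPairing F (N + N) (gramD F N T) v) c₀ hc₀ t)) ∧
        (∀ (t : v.adicCompletion F) (u : LocalSp F (N + N) (gramD F N T) v),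
          (∀ w, (u : _ ≃ₗ[v.adicCompletion F] _) w = w + t • 𝔫' w) →
            g₀ * u * g₀⁻¹ =
              partialWeyl (localGram F (N + N) (gramD F N T) v)
                  (UnitaryGroup.isUnit_det_map (algebraMap F (v.adicCompletion F)) (isUnit_det_gramD F N hTd))
                  e' *
                unipotentSp (localPairing F (N + N) (gramD F N T) v) (t • c₀')
                  (symm_smul_of_symm (localPairing F (N + N) (gramD F N T) v) c₀' hc₀' t) *
                (partialWeyl (localGram F (N + N) (gramD F N T) v)
                  (UnitaryGroup.isUnit_det_map (algebraMap F (v.adicCompletion F)) (isUnit_det_gramD F N hTd))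
                  e')⁻¹) := by
    haveI : CharZero (v.adicCompletion F) :=
      charZero_of_injective_algebraMap (algebraMap F (v.adicCompletion F)).injective
    haveI : Invertible (2 : v.adicCompletion F) := invertibleOfNonzero two_ne_zero
    obtain ⟨nr, nr', 𝔫, 𝔫', hp, hp', hsq, hsq', hskew, hskew', hd₁', hd₂', hrank, -, han, han'⟩ :=
      exists_doubledRootNilpotents_of_isotropic F E c hcδ₁ hδ₁ hd₁ hcδ₂ hδ₂ hd₂ T hT hTd hJ v hE hcls hr0 hr s₁ s₂ hs₁ hs₂
    exact ⟨nr, nr', 𝔫, 𝔫', hp, hp',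
      exists_mover_two_rootFamilies e' (localGram F (N + N) (gramD F N T) v)
        (UnitaryGroup.isUnit_det_map (algebraMap F (v.adicCompletion F)) (isUnit_det_gramD F N hTd)) 𝔫 𝔫'
        hskew hskew' hsq hsq' hd₁' hd₂' (hrank.trans (Fintype.card_fin 4).symm) han han'⟩
  obtain ⟨nr, nr', 𝔫, 𝔫', hp, hp', g₀, c₀, c₀', hc₀, hc₀', hsupp, hsupp', hanis, hanis', hconj, hconj'⟩ := hP34
  -- the ENGINE
  exact false_of_quasiInvariant_rootFamilies F v (N + N) (gramD F N T) (isUnit_det_gramD F N hTd)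
    e' Λ hΛ0 g₀
    (fun t => diagonalDoubling F E c v N s₁ s₂ (nr t)) (fun t => diagonalDoubling F E c v N s₁ s₂ (nr' t))
    (fun t => hΛ𝔻 (nr t)) (fun t => hΛ𝔻 (nr' t)) c₀ c₀' hc₀ hc₀' hsupp hsupp' hanis hanis'
    (fun t => hconj t _ (hp t)) (fun t => hconj' t _ (hp' t))

set_option maxHeartbeats 1000000 in -- the same statement, isotropy read in the Step-1 currency
/-- **The same, the isotropy hypothesis read in the Step-1 currency of [Liu2021, App. D §D.1]**: `LemD1.IsIsotropic` of the standing data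
`LemD1OfPlace.standingData E v c N J …` at `v` (★ `LemD1AsPrinted`, ★ `LemD1DataOfPlace`: «`(E_vᴺ, J ⊗ 1)` has a non-zero isotropic
vector», the reading of the print's «`V` is isotropic») in place of the explicit witness.  At `N = 2` this is the `ε`-clause of
[Liu2021, Lem. D.1 (4)] («`V` isotropic ⇒ `ε′ ~ ε`») at a non-split place for every pair of labels and arbitrary splittings.
[cite: Liu2021, App. D Lemma D.1 (4) (p. 126, l. 5235), proof l. 5257–5262] [cite: HarrisKudlaSweet1996, Cor. 4.4 p. 962]
[cite: SunZhu2014, Thm. 1.10] -/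
theorem rankOne_theta_lines_disjoint_of_isIsotropic_standingData (F : Type) [Field F] [NumberField F] (E : Type) [Field E]
    [NumberField E] [Algebra F E] [Algebra.IsQuadraticExtension F E] (c : E ≃ₐ[F] E) {N : ℕ} (hN : 2 ≤ N)
    (δ₁ : E) (hcδ₁ : c δ₁ = -δ₁) (hδ₁ : δ₁ ≠ 0) (d₁ : F) (hd₁ : δ₁ * δ₁ = algebraMap F E d₁)
    (δ₂ : E) (hcδ₂ : c δ₂ = -δ₂) (hδ₂ : δ₂ ≠ 0) (d₂ : F) (hd₂ : δ₂ * δ₂ = algebraMap F E d₂)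
    (T : Matrix (Fin N) (Fin N) F) (hT : T.IsSymm) (hTd : IsUnit T.det)
    (J : Matrix (Fin N) (Fin N) E) (hJ : J = T.map (algebraMap F E)) (hJh : (J.map c)ᵀ = J) (hJdet : J.det ≠ 0)
    (v : HeightOneSpectrum (𝓞 F)) (hE : IsField (UnitaryGroup.LocalRing E v))
    (hcls : ¬ ∃ x : (UnitaryGroup.LocalRing E v)ˣ,
      LemD1OfPlace.eps E v hδ₂ = x * Units.map (UnitaryGroup.conjLocal E c v : UnitaryGroup.LocalRing E v →* UnitaryGroup.LocalRing E v) x *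
        LemD1OfPlace.eps E v hδ₁)
    (hiso : LemD1.IsIsotropic (LemD1OfPlace.standingData E v c N J hcδ₁ hδ₁ hN hJh hJdet))
    (s₁ s₂ : UnitaryGroup.localPi E c N J v →* LocalMp F N T v)
    (hs₁ : ∀ g, MpPsi.proj _ (s₁ g) = iota F E c N hcδ₁ hδ₁ hd₁ T hT hJ v g)
    (hs₂ : ∀ g, MpPsi.proj _ (s₂ g) = iota F E c N hcδ₂ hδ₂ hd₂ T hT hJ v g)
    (hsm₁ : Representation.IsSmooth ((MpPsi.toRep (localSchrodinger F N T v)).comp s₁))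
    (hsm₂ : Representation.IsSmooth ((MpPsi.toRep (localSchrodinger F N T v)).comp s₂))
    (J₁ : Matrix (Fin 1) (Fin 1) E) (hJ₁ : J₁ 0 0 ≠ 0) (χ₁ χ₂ : UnitaryGroup.localPi E c 1 J₁ v →* ℂˣ)
    (hχ₁u : ∀ z, ‖((χ₁ z : ℂˣ) : ℂ)‖ = 1) (hχ₁c : Continuous fun z => ((χ₁ z : ℂˣ) : ℂ))
    (hχ₂u : ∀ z, ‖((χ₂ z : ℂˣ) : ℂ)‖ = 1) (hχ₂c : Continuous fun z => ((χ₂ z : ℂˣ) : ℂ))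
    (hnt : Nontrivial (TwistedCoinv.Coinv
      ((show Representation ℂ (UnitaryGroup.localPi E c 1 J₁ v) (SchwartzBruhat (Fin N → v.adicCompletion F)) from
        ((MpPsi.toRep (localSchrodinger F N T v)).comp s₁).comp (UnitaryGroup.localCenter E c N J J₁ hJ₁ v))) χ₁))
    (hiso' : AreIsomorphicRep
      (TwistedCoinv.rep
        (ρW := show Representation ℂ (UnitaryGroup.localPi E c 1 J₁ v) (SchwartzBruhat (Fin N → v.adicCompletion F)) from
          ((MpPsi.toRep (localSchrodinger F N T v)).comp s₁).comp (UnitaryGroup.localCenter E c N J J₁ hJ₁ v))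
        χ₁ ((MpPsi.toRep (localSchrodinger F N T v)).comp s₁)
        (fun g z => (show Commute g (UnitaryGroup.localCenter E c N J J₁ hJ₁ v z) from
          UnitaryGroup.localCenter_comm E c N J J₁ hJ₁ v z g).map ((MpPsi.toRep (localSchrodinger F N T v)).comp s₁)))
      (TwistedCoinv.rep
        (ρW := show Representation ℂ (UnitaryGroup.localPi E c 1 J₁ v) (SchwartzBruhat (Fin N → v.adicCompletion F)) from
          ((MpPsi.toRep (localSchrodinger F N T v)).comp s₂).comp (UnitaryGroup.localCenter E c N J J₁ hJ₁ v))
        χ₂ ((MpPsi.toRep (localSchrodinger F N T v)).comp s₂)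
        (fun g z => (show Commute g (UnitaryGroup.localCenter E c N J J₁ hJ₁ v z) from
          UnitaryGroup.localCenter_comm E c N J J₁ hJ₁ v z g).map ((MpPsi.toRep (localSchrodinger F N T v)).comp s₂)))) :
    False := by
  obtain ⟨r, hr0, hr⟩ := hiso
  exact rankOne_theta_lines_disjoint_of_isotropic F E c hN δ₁ hcδ₁ hδ₁ d₁ hd₁ δ₂ hcδ₂ hδ₂ d₂ hd₂ T hT hTd J hJ v hE hcls
    ⟨r, hr0, hr⟩ s₁ s₂ hs₁ hs₂ hsm₁ hsm₂ J₁ hJ₁ χ₁ χ₂ hχ₁u hχ₁c hχ₂u hχ₂c hnt hiso'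

end Literature.RepresentationTheory.MoeglinVignerasWaldspurger1987

end
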